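import Literature.Analysis.FluidPDE.NSLocalAnalyticityRadiusTube
import HarnessLib

/-!
# BGK local analyticity radius: reduction to solutions smooth across the initial time

Analysis/FluidPDE proofs file (theorems only), second companion of `NSLocalAnalyticityRadius.lean`
(named fact `bradshawGrujicKukavica2015_local_analyticity_radius`: Bradshaw–Grujić–Kukavica,
J. Differential Equations 259 (2015), Thm. 2.3; LMS Lecture Notes 430 (2016), Thm. 2.3.1).

The vendored statement carries no initial datum: `(u, p)` is only asked to be a smooth solution on
the OPEN cylinder `(0,T₀) × 4B_*` with the three local `L^q` quantities bounded. The printed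
theorem is run from a datum (`μ₀ = φu₀`, BGK 2015 §4, p. 16; BGK 2016 p. 29: the approximation
scheme starts from `μ⁽ⁿ⁾(·,0) = φu₀`). The passage between the two is the routine reduction proved
here, `bradshawGrujicKukavica2015_local_analyticity_radius_of_core`: **it suffices to establish the
conclusion of the fact, with constants `C₀ > 0`, `C ≥ 1`, for pairs `(u, p)` that are smooth
solutions on a cylinder `(-δ, T₀) × 4B_*` reaching across the initial time** (so that `u(0)` is a
smooth datum on `4B_*` and Duhamel's formula from `t = 0` is classical), with the same bounds on
`(-δ, T₀)`. Given a solution on `(0, T₀) × 4B_*` and a time `t` of the window, one applies the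
core statement to the time-translate `s ↦ u(s + ε)`, `0 < ε < t`, on `(-ε, T₀ - ε) × 4B_*`:
the majorants `A, B, D` are unchanged (`lintegral_Ioo_neg_sub_comp_add_right`), the local quantity
`M = A + B + T₀^{(r-2)/(2r)} D` does not increase (`r > 2`), and for `C ≥ 1` the window computed
with `T₀ - ε` contains the original window shifted by `ε` (`bgk_window_shift`; the degenerate
value `0⁻¹ = 0` of the third entry is matched by `bgk_inv_window_mono`); this gives the height
`√(t-ε)/(4C₀)` at time `t` (`exists_pos_lt_height_sqrt_sub`), and `ε ↓ 0` with the gluing lemma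
`exists_differentiableOn_localComplexTube_of_forall_lt` gives `√t/(4C₀)`. The restriction
`C ≥ 1` is harmless: the statement is antitone in `C`.

## Mathlib / tree search

Tree: `exists_differentiableOn_localComplexTube_of_forall_lt`, `localComplexTube_mono`
(`NSLocalAnalyticityRadiusTube.lean`, `NSLocalAnalyticityRadius.lean`). Mathlib:
`deriv_comp_add_const`, `lintegral_add_right_eq_self`, `lintegral_indicator`,
`Real.rpow_le_rpow`, `Real.rpow_eq_zero`, `inv_anti₀`, `ContDiffOn.comp`.

## References

* Z. Bradshaw, Z. Grujić, I. Kukavica, J. Differential Equations 259 (2015) 3955–3975, Thm. 2.3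
  (pp. 4–5) and §4 (p. 16: the scheme from `μ₀ = φu₀`). [BradshawGrujicKukavica2015]
* Z. Bradshaw, Z. Grujić, I. Kukavica, in LMS Lecture Notes 430 (CUP 2016), Thm. 2.3.1 and its
  proof sketch (PDF pp. 29–31). [BradshawGrujicKukavica2016]
-/

noncomputable section

open MeasureTheory Set Function Filter TopologicalSpace Metric
open _root_.Topology
open scoped ContDiff Laplacian InnerProductSpace RealInnerProductSpace
open Literature.Analysis.FunctionSpaces.EuclideanSpace (complexify complexify_apply norm_complexify
  complexify_injective continuous_complexify)

namespace Literature.Analysis.FluidPDE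

/-! ### Reduction to solutions smooth across the initial time

The vendored statement carries no initial datum: `(u, p)` is only asked to be smooth on the open
cylinder `(0,T₀) × 4B_*`. The printed theorem is run from a datum (`μ₀ = φu₀`, BGK 2015 §4;
BGK 2016 p. 29). The passage between the two is the following routine reduction, recorded here
as the last step of any proof of the fact: it suffices to treat pairs `(u, p)` which are smooth
solutions on a cylinder `(-δ, T₀) × 4B_*` reaching across the initial time `0` (so that `u(0)`
is a smooth datum and Duhamel's formula from `t = 0` is classical), with the same bounds there.
Given a solution on `(0,T₀) × 4B_*` and a time `t` of the window, apply the core statement to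
the time-translate `s ↦ u(ε + s)` (`0 < ε < t`; cylinder `(-ε, T₀ - ε) × 4B_*`, majorants
`A, B, D` unchanged, `M` not larger, window not smaller than the original one shifted by `ε`
when `C ≥ 1`), which gives the height `√(t - ε)/(4C₀)` at time `t`; then let `ε → 0` and glue
(`exists_differentiableOn_localComplexTube_of_forall_lt`). -/

section Reduction

/-- Translating the time integral: `∫_{(-ε, T₀-ε)} G(s + ε) ds = ∫_{(0,T₀)} G`. [folklore] -/
theorem lintegral_Ioo_neg_sub_comp_add_right (G : ℝ → ENNReal) (ε T₀ : ℝ) :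
    ∫⁻ s in Ioo (-ε) (T₀ - ε), G (s + ε) = ∫⁻ s in Ioo 0 T₀, G s := by
  rw [← lintegral_indicator measurableSet_Ioo, ← lintegral_indicator measurableSet_Ioo]
  have h : (fun s => (Ioo (-ε) (T₀ - ε)).indicator (fun s => G (s + ε)) s) =
      fun s => (Ioo 0 T₀).indicator G (s + ε) := by
    funext s
    by_cases hs : s ∈ Ioo (-ε) (T₀ - ε)
    · have hs' : s + ε ∈ Ioo 0 T₀ := ⟨by linarith [hs.1], by linarith [hs.2]⟩
      rw [indicator_of_mem hs, indicator_of_mem hs']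
    · have hs' : s + ε ∉ Ioo 0 T₀ := fun h => hs ⟨by linarith [h.1], by linarith [h.2]⟩
      rw [indicator_of_notMem hs, indicator_of_notMem hs']
  rw [h]
  exact lintegral_add_right_eq_self (fun s => (Ioo 0 T₀).indicator G s) ε

/-- Heights below `√t/(4C₀)` are reached from earlier times: for `h' < √t/(4C₀)` there is
`ε ∈ (0, t)` with `h' < √(t-ε)/(4C₀)`. [folklore] -/
theorem exists_pos_lt_height_sqrt_sub {C₀ t h' : ℝ} (hC₀ : 0 < C₀) (ht : 0 < t)
    (hh' : h' < Real.sqrt t / (4 * C₀)) :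
    ∃ ε : ℝ, 0 < ε ∧ ε < t ∧ h' < Real.sqrt (t - ε) / (4 * C₀) := by
  have h4 : 0 < 4 * C₀ := by positivity
  -- `s = max (4C₀h') 0` has `s² < t`
  set s : ℝ := max (4 * C₀ * h') 0 with hs
  have hs0 : 0 ≤ s := le_max_right _ _
  have hst : s ^ 2 < t := by
    rcases le_or_gt h' 0 with hh0 | hh0
    · have hs' : s = 0 := by
        rw [hs, max_eq_right]
        exact mul_nonpos_of_nonneg_of_nonpos h4.le hh0
      rw [hs']
      simpa using ht
    · have hs' : s = 4 * C₀ * h' := by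
        rw [hs, max_eq_left]
        exact (mul_pos h4 hh0).le
      have hlt : 4 * C₀ * h' < Real.sqrt t := by
        rw [lt_div_iff₀ h4] at hh'
        linarith
      rw [hs', ← Real.sq_sqrt ht.le]
      exact pow_lt_pow_left₀ hlt (mul_pos h4 hh0).le two_ne_zero
  refine ⟨(t - s ^ 2) / 2, by linarith, by nlinarith [sq_nonneg s], ?_⟩
  rw [lt_div_iff₀ h4]
  have h1 : s < Real.sqrt (t - (t - s ^ 2) / 2) := by
    rw [Real.lt_sqrt hs0]
    linarith
  have h2 : 4 * C₀ * h' ≤ s := le_max_left _ _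
  linarith

/-- Monotonicity of the third entry of the window in the local quantity: for `0 ≤ M' ≤ M`
(and `M = 0` whenever `M' = 0`, to cover Lean's `0⁻¹ = 0`),
`(q²(CM)^γ)⁻¹ ≤ (q²(CM')^γ)⁻¹`. [folklore] -/
theorem bgk_inv_window_mono {C q γ M M' : ℝ} (hC : 0 < C) (hq : q ≠ 0) (hγ : 0 < γ)
    (hM' : 0 ≤ M') (hMM : M' ≤ M) (h0 : M' = 0 → M = 0) :
    (q ^ 2 * (C * M) ^ γ)⁻¹ ≤ (q ^ 2 * (C * M') ^ γ)⁻¹ := by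
  have hq2 : 0 < q ^ 2 := by positivity
  have hCM' : 0 ≤ C * M' := mul_nonneg hC.le hM'
  rcases hM'.eq_or_lt with hz | hpos
  · -- degenerate case: both sides vanish
    have hM0 : M = 0 := h0 hz.symm
    rw [hM0, ← hz, mul_zero, Real.zero_rpow hγ.ne', mul_zero, inv_zero]
  · have hpow : 0 < (C * M') ^ γ := Real.rpow_pos_of_pos (mul_pos hC hpos) γ
    refine inv_anti₀ (mul_pos hq2 hpow) (mul_le_mul_of_nonneg_left ?_ hq2.le)
    exact Real.rpow_le_rpow hCM' (mul_le_mul_of_nonneg_left hMM hC.le) hγ.le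

/-- **The window is not smaller after a forward time shift** (`C ≥ 1`): if `t` lies in the
window computed with `T₀` and `0 < T₀' ≤ T₀`, then `t - (T₀ - T₀')` lies below the window
computed with `T₀'` (same `A, B, D`; the factor `T₀'^{(r-2)/(2r)} ≤ T₀^{(r-2)/(2r)}` as `r > 2`).
[folklore] -/
theorem bgk_window_shift {C q r T₀ T₀' rc A B D t : ℝ} (hC : 1 ≤ C) (hq : 3 < q)
    (hr : 2 * q / (q - 3) < r) (hT₀' : 0 < T₀') (hT : T₀' ≤ T₀) (hA : 0 ≤ A) (hB : 0 ≤ B)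
    (hD : 0 ≤ D)
    (ht : t < C⁻¹ * min (min T₀ (rc ^ 2))
      (q ^ 2 * (C * (A + B + T₀ ^ ((r - 2) / (2 * r)) * D)) ^ (2 * q / (q - 3)))⁻¹) :
    t - (T₀ - T₀') < C⁻¹ * min (min T₀' (rc ^ 2))
      (q ^ 2 * (C * (A + B + T₀' ^ ((r - 2) / (2 * r)) * D)) ^ (2 * q / (q - 3)))⁻¹ := by
  have hCpos : 0 < C := one_pos.trans_le hC
  have hCinv : C⁻¹ ≤ 1 := inv_le_one_of_one_le₀ hC
  have hCinv0 : 0 < C⁻¹ := inv_pos.2 hCpos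
  have hq3 : 0 < q - 3 := sub_pos.2 hq
  have hr2 : 2 < r := by
    have h1 : (2 : ℝ) < 2 * q / (q - 3) := by
      rw [lt_div_iff₀ hq3]
      linarith
    exact h1.trans hr
  have he0 : 0 < (r - 2) / (2 * r) := div_pos (by linarith) (by linarith)
  have hγ0 : 0 < 2 * q / (q - 3) := div_pos (by linarith) hq3
  -- the local quantity does not increase
  have hTe : T₀' ^ ((r - 2) / (2 * r)) ≤ T₀ ^ ((r - 2) / (2 * r)) :=
    Real.rpow_le_rpow hT₀'.le hT he0.le
  have hTe0 : 0 < T₀' ^ ((r - 2) / (2 * r)) := Real.rpow_pos_of_pos hT₀' _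
  have hMM : A + B + T₀' ^ ((r - 2) / (2 * r)) * D ≤ A + B + T₀ ^ ((r - 2) / (2 * r)) * D := by
    have := mul_le_mul_of_nonneg_right hTe hD
    linarith
  have hM'0 : 0 ≤ A + B + T₀' ^ ((r - 2) / (2 * r)) * D := by positivity
  have h0 : A + B + T₀' ^ ((r - 2) / (2 * r)) * D = 0 →
      A + B + T₀ ^ ((r - 2) / (2 * r)) * D = 0 := by
    intro hz
    have hP : 0 ≤ T₀' ^ ((r - 2) / (2 * r)) * D := mul_nonneg hTe0.le hD
    have hA0 : A = 0 := le_antisymm (by linarith) hA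
    have hB0 : B = 0 := le_antisymm (by linarith) hB
    have hPD : T₀' ^ ((r - 2) / (2 * r)) * D = 0 := by linarith
    have hD0 : D = 0 := by
      rcases mul_eq_zero.1 hPD with h | h
      · exact absurd h hTe0.ne'
      · exact h
    rw [hA0, hB0, hD0, mul_zero, add_zero, add_zero]
  have hXX := bgk_inv_window_mono (γ := 2 * q / (q - 3)) hCpos (by linarith : q ≠ 0) hγ0 hM'0 hMM h0
  -- compare the windows
  set m : ℝ := min (min T₀ (rc ^ 2))
    (q ^ 2 * (C * (A + B + T₀ ^ ((r - 2) / (2 * r)) * D)) ^ (2 * q / (q - 3)))⁻¹ with hm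
  have hmT₀ : m ≤ T₀ := (min_le_left _ _).trans (min_le_left _ _)
  have hmrc : m ≤ rc ^ 2 := (min_le_left _ _).trans (min_le_right _ _)
  have hmX : m ≤ (q ^ 2 * (C * (A + B + T₀ ^ ((r - 2) / (2 * r)) * D)) ^ (2 * q / (q - 3)))⁻¹ :=
    min_le_right _ _
  have h1 : m - (T₀ - T₀') ≤ min (min T₀' (rc ^ 2))
      (q ^ 2 * (C * (A + B + T₀' ^ ((r - 2) / (2 * r)) * D)) ^ (2 * q / (q - 3)))⁻¹ :=
    le_min (le_min (by linarith) (by linarith)) (by linarith)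
  have hε0 : 0 ≤ T₀ - T₀' := sub_nonneg.2 hT
  have h2 : C⁻¹ * (T₀ - T₀') ≤ T₀ - T₀' := by
    have := mul_le_mul_of_nonneg_right hCinv hε0
    rwa [one_mul] at this
  calc t - (T₀ - T₀') < C⁻¹ * m - (T₀ - T₀') := by linarith
    _ ≤ C⁻¹ * m - C⁻¹ * (T₀ - T₀') := by linarith
    _ = C⁻¹ * (m - (T₀ - T₀')) := by ring
    _ ≤ _ := mul_le_mul_of_nonneg_left h1 hCinv0.le

/-- A time in the window is smaller than `T₀` (`C ≥ 1`). [folklore] -/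
theorem bgk_lt_T₀_of_mem_window {C T₀ a X t : ℝ} (hC : 1 ≤ C) (ht0 : 0 < t)
    (ht : t < C⁻¹ * min (min T₀ a) X) : t < T₀ := by
  have hCpos : 0 < C := one_pos.trans_le hC
  have hCinv : C⁻¹ ≤ 1 := inv_le_one_of_one_le₀ hC
  have hCinv0 : 0 < C⁻¹ := inv_pos.2 hCpos
  have hm0 : 0 < min (min T₀ a) X := by
    by_contra hneg
    have : C⁻¹ * min (min T₀ a) X ≤ 0 := mul_nonpos_of_nonneg_of_nonpos hCinv0.le (not_lt.1 hneg)
    linarith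
  calc t < C⁻¹ * min (min T₀ a) X := ht
    _ ≤ 1 * min (min T₀ a) X := mul_le_mul_of_nonneg_right hCinv hm0.le
    _ = min (min T₀ a) X := one_mul _
    _ ≤ T₀ := (min_le_left _ _).trans (min_le_left _ _)

/-- **Reduction of the fact to solutions smooth across the initial time** (see the section
docstring): if the conclusion of the fact holds, with constants `C₀ > 0` and `C ≥ 1`, for all
pairs `(u, p)` that are smooth solutions on a cylinder `(-δ, T₀) × 4B_*`, `δ > 0`, with the three
local quantities bounded there, then the fact holds (with the same constants). Proof: time
translation by `ε ↓ 0` and gluing of the extensions over the increasing heights `√(t-ε)/(4C₀)`.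
[cite: BradshawGrujicKukavica2015, Thm. 2.3 and §4 (the scheme is run from the datum `φu₀`)] -/
theorem bradshawGrujicKukavica2015_local_analyticity_radius_of_core {C₀ C : ℝ} (hC₀ : 0 < C₀)
    (hC : 1 ≤ C)
    (hcore : ∀ (xc : EuclideanSpace ℝ (Fin 3)) ⦃rc T₀ q r δ : ℝ⦄, 0 < rc → 0 < T₀ → 3 < q →
      2 * q / (q - 3) < r → 0 < δ →
      ∀ ⦃u : ℝ → EuclideanSpace ℝ (Fin 3) → EuclideanSpace ℝ (Fin 3)⦄
        ⦃p : ℝ → EuclideanSpace ℝ (Fin 3) → ℝ⦄,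
        ContDiffOn ℝ ∞ (uncurry u) (Ioo (-δ) T₀ ×ˢ ball xc (4 * rc)) →
        ContDiffOn ℝ ∞ (uncurry p) (Ioo (-δ) T₀ ×ˢ ball xc (4 * rc)) →
        (∀ t ∈ Ioo (-δ) T₀, ∀ x ∈ ball xc (4 * rc),
          deriv (fun s => u s x) t + convect (u t) (u t) x = Δ (u t) x - gradient (p t) x) →
        (∀ t ∈ Ioo (-δ) T₀, ∀ x ∈ ball xc (4 * rc), VectorCalculus.divergence (u t) x = 0) →
        ∀ ⦃A B D : ℝ⦄, 0 ≤ A → 0 ≤ B → 0 ≤ D →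
        (∀ t ∈ Ioo (-δ) T₀, eLpNorm (u t) (ENNReal.ofReal q)
            (volume.restrict (ball xc (4 * rc))) ≤ ENNReal.ofReal A) →
        (∀ t ∈ Ioo (-δ) T₀, eLpNorm (p t) (ENNReal.ofReal (q / 2))
            (volume.restrict (ball xc (4 * rc))) ≤ ENNReal.ofReal (B ^ 2)) →
        (∫⁻ t in Ioo (-δ) T₀, eLpNorm (fun x => Real.sqrt (frobeniusNormSq (fderiv ℝ (u t) x)))
            (ENNReal.ofReal q) (volume.restrict (ball xc (4 * rc))) ^ r ≤
          ENNReal.ofReal (D ^ r)) →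
        ∀ t ∈ Ioo 0 (C⁻¹ * min (min T₀ (rc ^ 2))
            (q ^ 2 * (C * (A + B + T₀ ^ ((r - 2) / (2 * r)) * D)) ^ (2 * q / (q - 3)))⁻¹),
          ∃ U : EuclideanSpace ℂ (Fin 3) → EuclideanSpace ℂ (Fin 3),
            DifferentiableOn ℂ U (localComplexTube xc rc (Real.sqrt t / (4 * C₀))) ∧
            ∀ x ∈ ball xc rc, U (complexify x) = complexify (u t x)) :
    bradshawGrujicKukavica2015_local_analyticity_radius := by
  refine ⟨C₀, C, hC₀, one_pos.trans_le hC, ?_⟩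
  intro xc rc T₀ q r hrc hT₀ hq hr u p hu hp hns hdiv A B D hA hB hD huA hpB hgrad t ht
  have ht0 : 0 < t := ht.1
  have htT₀ : t < T₀ := bgk_lt_T₀_of_mem_window hC ht0 ht.2
  -- glue over the heights `h' < √t/(4C₀)`
  refine exists_differentiableOn_localComplexTube_of_forall_lt fun h' hh' => ?_
  obtain ⟨ε, hε0, hεt, hheight⟩ := exists_pos_lt_height_sqrt_sub hC₀ ht0 hh'
  -- the translated solution on `(-ε, T₀ - ε) × 4B`
  have hT₀' : 0 < T₀ - ε := by linarith
  have hshift : ∀ s' ∈ Ioo (-ε) (T₀ - ε), s' + ε ∈ Ioo 0 T₀ := fun s' hs' =>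
    ⟨by linarith [hs'.1], by linarith [hs'.2]⟩
  have hmaps : MapsTo (fun z : ℝ × EuclideanSpace ℝ (Fin 3) => (z.1 + ε, z.2))
      (Ioo (-ε) (T₀ - ε) ×ˢ ball xc (4 * rc)) (Ioo 0 T₀ ×ˢ ball xc (4 * rc)) :=
    fun z hz => ⟨hshift z.1 hz.1, hz.2⟩
  have haff : ContDiff ℝ ∞ (fun z : ℝ × EuclideanSpace ℝ (Fin 3) => (z.1 + ε, z.2)) :=
    (contDiff_fst.add contDiff_const).prodMk contDiff_snd
  have hu'c : ContDiffOn ℝ ∞ (uncurry fun s' => u (s' + ε))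
      (Ioo (-ε) (T₀ - ε) ×ˢ ball xc (4 * rc)) :=
    hu.comp haff.contDiffOn hmaps
  have hp'c : ContDiffOn ℝ ∞ (uncurry fun s' => p (s' + ε))
      (Ioo (-ε) (T₀ - ε) ×ˢ ball xc (4 * rc)) :=
    hp.comp haff.contDiffOn hmaps
  have hns' : ∀ s' ∈ Ioo (-ε) (T₀ - ε), ∀ x ∈ ball xc (4 * rc),
      deriv (fun σ => u (σ + ε) x) s' + convect (u (s' + ε)) (u (s' + ε)) x =
        Δ (u (s' + ε)) x - gradient (p (s' + ε)) x := by
    intro s' hs' x hx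
    rw [deriv_comp_add_const (fun σ => u σ x) ε s']
    exact hns (s' + ε) (hshift s' hs') x hx
  have hdiv' : ∀ s' ∈ Ioo (-ε) (T₀ - ε), ∀ x ∈ ball xc (4 * rc),
      VectorCalculus.divergence (u (s' + ε)) x = 0 :=
    fun s' hs' x hx => hdiv (s' + ε) (hshift s' hs') x hx
  have huA' : ∀ s' ∈ Ioo (-ε) (T₀ - ε), eLpNorm (u (s' + ε)) (ENNReal.ofReal q)
      (volume.restrict (ball xc (4 * rc))) ≤ ENNReal.ofReal A :=
    fun s' hs' => huA (s' + ε) (hshift s' hs')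
  have hpB' : ∀ s' ∈ Ioo (-ε) (T₀ - ε), eLpNorm (p (s' + ε)) (ENNReal.ofReal (q / 2))
      (volume.restrict (ball xc (4 * rc))) ≤ ENNReal.ofReal (B ^ 2) :=
    fun s' hs' => hpB (s' + ε) (hshift s' hs')
  have hgrad' : ∫⁻ s' in Ioo (-ε) (T₀ - ε),
      eLpNorm (fun x => Real.sqrt (frobeniusNormSq (fderiv ℝ (u (s' + ε)) x))) (ENNReal.ofReal q)
        (volume.restrict (ball xc (4 * rc))) ^ r ≤ ENNReal.ofReal (D ^ r) := by
    rw [lintegral_Ioo_neg_sub_comp_add_right (fun τ => eLpNorm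
      (fun x => Real.sqrt (frobeniusNormSq (fderiv ℝ (u τ) x))) (ENNReal.ofReal q)
        (volume.restrict (ball xc (4 * rc))) ^ r) ε T₀]
    exact hgrad
  -- the window of the translated solution contains `t - ε`
  have hwin' := bgk_window_shift (rc := rc) hC hq hr hT₀' (by linarith) hA hB hD ht.2
  have hTT : T₀ - (T₀ - ε) = ε := by ring
  rw [hTT] at hwin'
  obtain ⟨U, hUd, hUf⟩ := hcore xc hrc hT₀' hq hr hε0 hu'c hp'c hns' hdiv' hA hB hD huA' hpB'
    hgrad' (t - ε) ⟨by linarith, hwin'⟩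
  refine ⟨U, hUd.mono (localComplexTube_mono le_rfl hheight.le), fun x hx => ?_⟩
  rw [hUf x hx, sub_add_cancel]

end Reduction

end Literature.Analysis.FluidPDE

end
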